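import Summits.Ventures.CertifiedManyBodySolver.Downfold.BoxesLa214V115M2c
import Summits.Ventures.CertifiedManyBodySolver.Observables.StiffnessApexTransportTargetSlot
import HarnessLib

/-!
# M2(c) «LSCO x = 1/8» closers WITHOUT ANY `K₂` INPUT: the TARGET-SLOT station on `boxLa214E_M15v115`
# (`[−3/10, −1/5] × [29/5, 74/5] × [171/200, 179/200]`, station `29/5`)

Venture CertifiedManyBodySolver, cell `pub/hubbard-downfold` (MO-S1 ↔ S2 seam, D-0150 L-DF2 «box ↦ one word»; D-0154 coverage); namespace
`Summit.Ventures.CertifiedManyBodySolver.Downfold`; seat hubbard-downfold-unc-2 (`prover-hubbard-downfold-unc-2-g15-0`). Companion of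
`Downfold/BoxesLa214V115M2c.lean` (one station, own slots, lever `27/148`, «min K₂diag» load-bearing) and `…M2cCurtain.lean` (corner slot, lever `1/10`)
on `Observables/StiffnessApexTransportTargetSlot.lean`: here the station family is read at the TARGET's own slot, so there is NO lever and NO `K₂` word —
the doped box closes from f-sum-objective station certificates alone, each vertex read with the objectives `−X₀(σ)` for the slots `σ` it serves
(`σ ∈ [−3/10, −1/5]`, sources `s ∈ [119σ/74, σ]` at `U = 29/5`; `2 − (29/5)/(74/5) = 119/74`).

* `la214E_M2c_targetSlot_factor` — `2 − (29/5)/(74/5) = 119/74` (so the far source of the slot `−3/10` is `−357/740`, of `−1/5` is `−119/370`);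
* `boxLa214E_M15v115_stiffnessWord_of_apexStation29o5_targetSlot_doped` — density-indexed two-parameter family `val x σ s` ⇒ the stiffness word;
* `boxLa214E_M15v115_stiffnessWord_of_apexStation29o5_targetSlot_twoObjectives_doped` — the family as the `σ`-CHORD of the two END objectives
  `−X₀(−3/10)`, `−X₀(−1/5)` (families `vP x s`, `vQ x s`): every station certificate read with two objectives, interpolated in `σ` (covariance-free).

Everything here is PROVED; no `sorry`, no definition. HONEST FRAMING: one-sided stiffness CEILINGS conditional BY NAME on the families plugged in
(CONTROL/CALIBRATION class + labelled Mott-proximity HEURISTIC); typing certifies nothing about La₁.₈₇₅Sr₀.₁₂₅CuO₄; a ceiling never speaks to the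
presence of order; no `T_c`, no superconductivity verdict, no phase sentence.
-/

noncomputable section

namespace Summit.Ventures.CertifiedManyBodySolver.Downfold

open Set NonemptyInterval Filter
open Summit.Ventures.CertifiedManyBodySolver.Observables
open Summit.Ventures.CertifiedManyBodySolver.Certificates
open Literature.MathematicalPhysics.QuantumLattice Literature.MathematicalPhysics.QuantumLattice.ThermodynamicLimit
open Literature.Probability.LatticeModels

/-- The station factor of «La214-E»: `2 − (29/5)/(74/5) = 119/74`; hence `(−3/10)·(119/74) = −357/740` and `(−1/5)·(119/74) = −119/370`. [folklore] -/
theorem la214E_M2c_targetSlot_factor :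
    (2 : ℝ) - 29 / 5 / (74 / 5) = 119 / 74 ∧ (-3 / 10 : ℝ) * (119 / 74) = -(357 / 740) ∧ (-1 / 5 : ℝ) * (119 / 74) = -(119 / 370) := by
  refine ⟨?_, ?_, ?_⟩ <;> norm_num

/-- **M2(c) CLOSER — TARGET-SLOT STATION, doped, NO `K₂` INPUT.** Station `U_A = 29/5`; for every density `x ∈ [171/200, 179/200]`, every target slot
`σ ∈ [−3/10, −1/5]` and every source `s ∈ [119σ/74, σ]`: an unconditional orbit-lower statement `val x σ s ≤ |D₄|⁻¹ Σ_γ Re ω_γ(−X₀(σ, 29/5))` on the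
torus-limit ground-state class at `(s, 29/5, x)`, with `−val x σ s ≤ c`. Then the stiffness word `c` holds on `boxLa214E_M15v115` — no lever, no «min K₂diag»
word, no particle–hole window. [cite: KomaTasaki1994, §1] [cite: ScalapinoWhiteZhang1993, §II] -/
theorem boxLa214E_M15v115_stiffnessWord_of_apexStation29o5_targetSlot_doped (val : ℝ → ℝ → ℝ → ℝ) (c : ℚ)
    (h : ∀ x ∈ Set.Icc (171 / 200 : ℝ) (179 / 200), ∀ σ ∈ Set.Icc (-3 / 10 : ℝ) (-1 / 5), ∀ s ∈ Set.Icc (σ * (119 / 74)) σ,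
      ∀ (ω : InfVolFermionState 2) (Ls : ℕ → ℕ) (ψ : ∀ L, Fock (Orb (FermionTorus 2 L))),
      Tendsto Ls atTop atTop →
      (∀ j, IsGroundStateInSector (hubbardTorusTT' (Ls j) 1 s (29 / 5)) (rectN x (Ls j)) 0 (ψ (Ls j))) →
      (∀ j, star (ψ (Ls j)) ⬝ᵥ ψ (Ls j) = 1) → ω.IsTorusLimitOf ψ Ls →
      val x σ s ≤ ((Finset.univ : Finset (DihedralGroup 4)).card : ℝ)⁻¹ * ∑ g ∈ (Finset.univ : Finset (DihedralGroup 4)),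
        (ω.expect (d4ShiftSet g 0 (Literature.Probability.LatticeModels.box 2 7))
          (fermionEmbed (PolySite.d4Emb g 0 (Literature.Probability.LatticeModels.box 2 7)) (-oddMomentObsTT σ (29 / 5) 0))).re)
    (hc : ∀ x ∈ Set.Icc (171 / 200 : ℝ) (179 / 200), ∀ σ ∈ Set.Icc (-3 / 10 : ℝ) (-1 / 5), ∀ s ∈ Set.Icc (σ * (119 / 74)) σ,
      -val x σ s ≤ ((c : ℚ) : ℝ)) :
    HoldsOn (fun p : OneBandCoord → ℝ => ObsStiffnessSeqCeilingAt (p .tpOverT) (p .UOverT) (p .filling) c)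
      boxLa214E_M15v115 := by
  obtain ⟨e, -, -⟩ := la214E_M2c_targetSlot_factor
  refine boxLa214E_M15v115_stiffnessWord_of_cellLeaf ?_
  have hbox := ObsStiffnessSeqCeilingAt_on_box3_of_apexStation_targetSlot (p := -3 / 10) (q := -1 / 5) (UA := 29 / 5) (Umax := 74 / 5)
    (n₁ := 171 / 200) (n₂ := 179 / 200) (by norm_num) (by norm_num) (by norm_num) (by norm_num) val c
    (fun x hx σ hσ s hs => h x hx σ hσ s (by rwa [e] at hs)) (fun x hx σ hσ s hs => hc x hx σ hσ s (by rwa [e] at hs))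
  intro tp htp U hU n hn
  exact hbox tp htp U hU n hn

/-- **M2(c) CLOSER — TARGET-SLOT STATION read with the TWO END OBJECTIVES.** For every density `x ∈ [171/200, 179/200]`: two families on the station,
`vP x s` certified for the objective `−X₀(−3/10)` and `vQ x s` for `−X₀(−1/5)`, such that at every target slot `σ ∈ [−3/10, −1/5]` and source `s ∈ [119σ/74, σ]`
the `σ`-CHORD `((−1/5 − σ)·vP x s + (σ + 3/10)·vQ x s)/(1/10)` is an orbit-lower value for `−X₀(σ, 29/5)` on the class at `(s, 29/5, x)` (what interpolating each
station certificate's two objective reads in `σ` gives), with `−vP x s ≤ c`, `−vQ x s ≤ c` there. Then the stiffness word `c` holds on `boxLa214E_M15v115`.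
[cite: KomaTasaki1994, §1] [cite: ScalapinoWhiteZhang1993, §II] -/
theorem boxLa214E_M15v115_stiffnessWord_of_apexStation29o5_targetSlot_twoObjectives_doped (vP vQ : ℝ → ℝ → ℝ) (c : ℚ)
    (h : ∀ x ∈ Set.Icc (171 / 200 : ℝ) (179 / 200), ∀ σ ∈ Set.Icc (-3 / 10 : ℝ) (-1 / 5), ∀ s ∈ Set.Icc (σ * (119 / 74)) σ,
      ∀ (ω : InfVolFermionState 2) (Ls : ℕ → ℕ) (ψ : ∀ L, Fock (Orb (FermionTorus 2 L))),
      Tendsto Ls atTop atTop →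
      (∀ j, IsGroundStateInSector (hubbardTorusTT' (Ls j) 1 s (29 / 5)) (rectN x (Ls j)) 0 (ψ (Ls j))) →
      (∀ j, star (ψ (Ls j)) ⬝ᵥ ψ (Ls j) = 1) → ω.IsTorusLimitOf ψ Ls →
      (-1 / 5 - σ) / (-1 / 5 - -3 / 10) * vP x s + (σ - -3 / 10) / (-1 / 5 - -3 / 10) * vQ x s ≤
        ((Finset.univ : Finset (DihedralGroup 4)).card : ℝ)⁻¹ * ∑ g ∈ (Finset.univ : Finset (DihedralGroup 4)),
          (ω.expect (d4ShiftSet g 0 (Literature.Probability.LatticeModels.box 2 7))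
            (fermionEmbed (PolySite.d4Emb g 0 (Literature.Probability.LatticeModels.box 2 7)) (-oddMomentObsTT σ (29 / 5) 0))).re)
    (hcP : ∀ x ∈ Set.Icc (171 / 200 : ℝ) (179 / 200), ∀ σ ∈ Set.Icc (-3 / 10 : ℝ) (-1 / 5), ∀ s ∈ Set.Icc (σ * (119 / 74)) σ,
      -vP x s ≤ ((c : ℚ) : ℝ))
    (hcQ : ∀ x ∈ Set.Icc (171 / 200 : ℝ) (179 / 200), ∀ σ ∈ Set.Icc (-3 / 10 : ℝ) (-1 / 5), ∀ s ∈ Set.Icc (σ * (119 / 74)) σ,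
      -vQ x s ≤ ((c : ℚ) : ℝ)) :
    HoldsOn (fun p : OneBandCoord → ℝ => ObsStiffnessSeqCeilingAt (p .tpOverT) (p .UOverT) (p .filling) c)
      boxLa214E_M15v115 := by
  obtain ⟨e, -, -⟩ := la214E_M2c_targetSlot_factor
  refine boxLa214E_M15v115_stiffnessWord_of_cellLeaf fun tp htp U hU n hn => ?_
  exact ObsStiffnessSeqCeilingAt_on_box_of_apexStation_targetSlot_chord (p := -3 / 10) (q := -1 / 5) (UA := 29 / 5) (Umax := 74 / 5)
    (n := n) (by norm_num) (by norm_num) (by norm_num) (by linarith [hn.1]) (by linarith [hn.2]) (vP n) (vQ n) c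
    (fun σ hσ s hs => h n hn σ hσ s (by rwa [e] at hs)) (fun σ hσ s hs => hcP n hn σ hσ s (by rwa [e] at hs))
    (fun σ hσ s hs => hcQ n hn σ hσ s (by rwa [e] at hs)) tp htp U hU

/-! ## (append, same seat) M2(c) from TWO ORDINARY STATION BUNDLES — the end objectives `−X₀(−3/10)`, `−X₀(−1/5)` on `[−357/740, −1/5] × {29/5}` -/

/-- **M2(c) CLOSER — TWO END-OBJECTIVE BUNDLES, doped, NO `K₂` INPUT.** Station `U_A = 29/5`; for every density `x ∈ [171/200, 179/200]` two unconditional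
orbit-lower families on the WHOLE station segment `s ∈ [−357/740, −1/5]` (torus-limit ground-state classes at `(s, 29/5, x)`): `vP x s` for the objective
`−X₀(−3/10, 29/5)` and `vQ x s` for `−X₀(−1/5, 29/5)` — the same vertex solves read with the two END objectives, each bundled along `s` as usual — and the
price on the σ-chord: for every target slot `σ ∈ [−3/10, −1/5]` and source `s ∈ [119σ/74, σ]`,
`−((−1/5 − σ)·vP x s + (σ + 3/10)·vQ x s)/(1/10) ≤ c`. Then the stiffness word `c` holds on `boxLa214E_M15v115`
(`ObsStiffnessSeqCeilingAt_on_box_of_apexStation_twoEndObjectives`: the f-sum orbit mean is affine in the slot). [cite: KomaTasaki1994, §1] [cite: ScalapinoWhiteZhang1993, §II] -/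
theorem boxLa214E_M15v115_stiffnessWord_of_apexStation29o5_twoEndObjectives_doped (vP vQ : ℝ → ℝ → ℝ) (c : ℚ)
    (hP : ∀ x ∈ Set.Icc (171 / 200 : ℝ) (179 / 200), ∀ s ∈ Set.Icc (-(357 / 740) : ℝ) (-1 / 5),
      ∀ (ω : InfVolFermionState 2) (Ls : ℕ → ℕ) (ψ : ∀ L, Fock (Orb (FermionTorus 2 L))),
      Tendsto Ls atTop atTop →
      (∀ j, IsGroundStateInSector (hubbardTorusTT' (Ls j) 1 s (29 / 5)) (rectN x (Ls j)) 0 (ψ (Ls j))) →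
      (∀ j, star (ψ (Ls j)) ⬝ᵥ ψ (Ls j) = 1) → ω.IsTorusLimitOf ψ Ls →
      vP x s ≤ ((Finset.univ : Finset (DihedralGroup 4)).card : ℝ)⁻¹ * ∑ g ∈ (Finset.univ : Finset (DihedralGroup 4)),
        (ω.expect (d4ShiftSet g 0 (Literature.Probability.LatticeModels.box 2 7))
          (fermionEmbed (PolySite.d4Emb g 0 (Literature.Probability.LatticeModels.box 2 7)) (-oddMomentObsTT (-3 / 10) (29 / 5) 0))).re)
    (hQ : ∀ x ∈ Set.Icc (171 / 200 : ℝ) (179 / 200), ∀ s ∈ Set.Icc (-(357 / 740) : ℝ) (-1 / 5),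
      ∀ (ω : InfVolFermionState 2) (Ls : ℕ → ℕ) (ψ : ∀ L, Fock (Orb (FermionTorus 2 L))),
      Tendsto Ls atTop atTop →
      (∀ j, IsGroundStateInSector (hubbardTorusTT' (Ls j) 1 s (29 / 5)) (rectN x (Ls j)) 0 (ψ (Ls j))) →
      (∀ j, star (ψ (Ls j)) ⬝ᵥ ψ (Ls j) = 1) → ω.IsTorusLimitOf ψ Ls →
      vQ x s ≤ ((Finset.univ : Finset (DihedralGroup 4)).card : ℝ)⁻¹ * ∑ g ∈ (Finset.univ : Finset (DihedralGroup 4)),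
        (ω.expect (d4ShiftSet g 0 (Literature.Probability.LatticeModels.box 2 7))
          (fermionEmbed (PolySite.d4Emb g 0 (Literature.Probability.LatticeModels.box 2 7)) (-oddMomentObsTT (-1 / 5) (29 / 5) 0))).re)
    (hc : ∀ x ∈ Set.Icc (171 / 200 : ℝ) (179 / 200), ∀ σ ∈ Set.Icc (-3 / 10 : ℝ) (-1 / 5), ∀ s ∈ Set.Icc (σ * (119 / 74)) σ,
      -((-1 / 5 - σ) / (-1 / 5 - -3 / 10) * vP x s + (σ - -3 / 10) / (-1 / 5 - -3 / 10) * vQ x s) ≤ ((c : ℚ) : ℝ)) :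
    HoldsOn (fun p : OneBandCoord → ℝ => ObsStiffnessSeqCeilingAt (p .tpOverT) (p .UOverT) (p .filling) c)
      boxLa214E_M15v115 := by
  obtain ⟨e, eP, -⟩ := la214E_M2c_targetSlot_factor
  refine boxLa214E_M15v115_stiffnessWord_of_cellLeaf fun tp htp U hU n hn => ?_
  refine ObsStiffnessSeqCeilingAt_on_box_of_apexStation_twoEndObjectives (p := -3 / 10) (q := -1 / 5) (UA := 29 / 5) (Umax := 74 / 5)
    (n := n) (by norm_num) (by norm_num) (by norm_num) (by linarith [hn.1]) (by linarith [hn.2]) (vP n) (vQ n) c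
    (fun s hs => hP n hn s (by rwa [e, eP] at hs)) (fun s hs => hQ n hn s (by rwa [e, eP] at hs))
    (fun σ hσ s hs => hc n hn σ hσ s (by rwa [e] at hs)) tp htp U hU

end Summit.Ventures.CertifiedManyBodySolver.Downfold

end
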